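import Summits.PneNP.PneNP.Theorems.SfmBlMachineTraceSem

/-!
# Sign-degree-2 engine, MACHINE LAYER M3-SEM for a GENERIC leg type: the machine's `traceSum` IS the cylinder sum
# of the remainder traces (cell pnp-ideate, ROUND-18 item K1'' `SignDeg2Signing.SignDeg2SigningFP`, stage S3)

FRONTIER (range avoidance for sign-degree-≤2 local maps at linear stretch; restricted-model algorithmic
rung); nothing here bears on P vs NP.

Twin of prover-1's `SfmBlMachine.traceSum_eq_sum_cylinder` (legs `Fin m × Fin 3`, remainder selected by a part
labelling) for an ARBITRARY finite leg type `Λ` (to be instantiated with the remainder subtype `{e // p e = none}`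
of the certificate leg system `SignDeg2Legs.CLeg c`): pieces `srcL : Λ → α`, `dstL : Λ → β`, outputs
`outL : Λ → Fin m`, an injective record map `φ : Λ → PLeg` onto the machine's duplicate-free remainder list `rl`
(`x ∈ rl ↔ ∃ e, φ e = x`) with `labL (φ e) = ι₁ (srcL e)`, `labR (φ e) = ι₂ (dstL e)`, `(φ e).1 = outL e`
(`ι₁`, `ι₂` injective).  Then for every prefix `(k ≤ m, T0)`, every `q` and a non-binding cap:
**`traceSum_eq_sum_cylinder_gen`** —
`(traceSum k T0 2^(m−k+1) rl cap u : ℝ) = Σ_{T : ∀ i < k, T i = T0[i]} tr((fromBlocks 0 (MR T) (MR T)ᵀ 0)^{2(q+1)})`,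
`|u| = 2q + 1`, `MR T i k = Σ_{e : srcL e = i, dstL e = k} χ(T (outL e))`.  Ingredients: prover-1's
`traceSum_eq_sum_pairs`, `contrib_eq`, `count_outs_seqOf` (machine side), p3's GENERIC `SfmBl.sum_cylinder_trace_pow_eq`
(weights `w = 1`), `prod_even_indicator`, `prod_boolSign_pow_eq_neg_one_pow`, and the reindexing `Fin |rl| ≃ Λ`.
-/

set_option linter.dupNamespace false -- `Summit.PneNP.PneNP.…`: summit = sub-problem name (D-0017 single-conjunct layout)

namespace Summit.PneNP.PneNP.Theorems.Sd2BlMachine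

open Finset Matrix
open Literature.Computability.Complexity (IsAdmissible)
open Summit.PneNP.PneNP.Theorems.SfmBlMachine
open Summit.PneNP.PneNP.Theorems.SfmBl (sum_cylinder_trace_pow_eq prod_even_indicator prod_boolSign_pow_eq_neg_one_pow)

section Sem

variable {α β Λ : Type} [Fintype α] [Fintype β] [DecidableEq α] [DecidableEq β] [Fintype Λ] [DecidableEq Λ] {m : ℕ}
  {srcL : Λ → α} {dstL : Λ → β} {outL : Λ → Fin m} {ι₁ : α → Lab} {ι₂ : β → Lab} {φ : Λ → PLeg} {rl : List PLeg}

/-! ## The reindexing `Fin |rl| ≃ Λ` -/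

/-- The leg whose record sits at position `a` of the list. -/
noncomputable def rlLegG (hmem : ∀ x, x ∈ rl ↔ ∃ e, φ e = x) (a : Fin rl.length) : Λ :=
  Classical.choose ((hmem _).1 (List.getElem_mem a.isLt))

omit [Fintype Λ] [DecidableEq Λ] in
/-- Its record is the list item. -/
theorem φ_rlLegG (hmem : ∀ x, x ∈ rl ↔ ∃ e, φ e = x) (a : Fin rl.length) : φ (rlLegG hmem a) = rl.get a :=
  Classical.choose_spec ((hmem _).1 (List.getElem_mem a.isLt))

omit [Fintype Λ] [DecidableEq Λ] in
/-- `rlLegG` is a bijection (injective records, duplicate-free list). -/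
theorem rlLegG_bijective (hφ : Function.Injective φ) (hrl : rl.Nodup) (hmem : ∀ x, x ∈ rl ↔ ∃ e, φ e = x) :
    Function.Bijective (rlLegG hmem) := by
  constructor
  · intro a b h
    have h1 := φ_rlLegG hmem a; have h2 := φ_rlLegG hmem b
    rw [h] at h1
    exact (List.nodup_iff_injective_get.1 hrl) (h1.symm.trans h2)
  · intro e
    obtain ⟨a, ha⟩ := List.get_of_mem ((hmem _).2 ⟨e, rfl⟩)
    refine ⟨a, hφ ?_⟩
    rw [φ_rlLegG hmem a, ha]

/-- The reindexing equivalence. -/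
noncomputable def rlEquivG (hφ : Function.Injective φ) (hrl : rl.Nodup) (hmem : ∀ x, x ∈ rl ↔ ∃ e, φ e = x) :
    Fin rl.length ≃ Λ :=
  Equiv.ofBijective (rlLegG hmem) (rlLegG_bijective hφ hrl hmem)

/-! ## The termwise identity -/

omit [Fintype Λ] [DecidableEq Λ] in
/-- Multiplicity of an output among the legs of a pair of leg functions, `ℕ`-indexed. -/
theorem muG_nat_eq {q : ℕ} (L L' : Fin (q + 1) → Λ) (i : Fin m) :
    (univ.filter fun j => (outL (L j)).val = i.val).card + (univ.filter fun j => (outL (L' j)).val = i.val).card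
      = (univ.filter fun j => outL (L j) = i).card + (univ.filter fun j => outL (L' j) = i).card := by
  congr 1 <;> exact congrArg _ (filter_congr fun j _ => Fin.val_inj)

omit [Fintype Λ] [DecidableEq Λ] in
/-- Outputs `≥ m` do not occur. -/
theorem muG_nat_eq_zero {q : ℕ} (L L' : Fin (q + 1) → Λ) {i : ℕ} (hi : m ≤ i) :
    (univ.filter fun j => (outL (L j)).val = i).card + (univ.filter fun j => (outL (L' j)).val = i).card = 0 := by
  rw [Finset.card_eq_zero.2 (Finset.filter_eq_empty_iff.2 fun j _ h => absurd ((outL (L j)).isLt) (by omega)),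
    Finset.card_eq_zero.2 (Finset.filter_eq_empty_iff.2 fun j _ h => absurd ((outL (L' j)).isLt) (by omega))]

omit [Fintype Λ] [DecidableEq Λ] in
/-- THE TERM OF ONE PAIR: the machine's contribution (through the records) is p3's cylinder term times `2`,
with `pw = 2^{m−k+1}`. -/
theorem contrib_seqOf_eq_gen (hO : ∀ e, (φ e).1 = (outL e).val)
    {k : ℕ} (hk : k ≤ m) (T0 : List Bool) {q : ℕ} (L L' : Fin (q + 1) → Λ) :
    ((contrib k T0 (2 ^ (m - k + 1)) (seqOf (fun j => φ (L j)) (fun j => φ (L' j))) : ℤ) : ℝ)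
      = 2 * ((∏ i ∈ univ.filter (fun i : Fin m => (i : ℕ) < k),
              (((CandCutNorm.boolSign (T0.getD i.val false) : ℤ) : ℝ)) ^
                ((univ.filter (fun j => outL (L j) = i)).card + (univ.filter (fun j => outL (L' j) = i)).card))
            * ∏ i ∈ (univ.filter fun i : Fin m => (i : ℕ) < k)ᶜ,
              (if Even ((univ.filter (fun j => outL (L j) = i)).card + (univ.filter (fun j => outL (L' j) = i)).card)
                then (2 : ℝ) else 0)) := by
  classical
  set P := univ.filter fun i : Fin m => (i : ℕ) < k with hP
  set μ : Fin m → ℕ := fun i => (univ.filter (fun j => outL (L j) = i)).card + (univ.filter (fun j => outL (L' j) = i)).card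
    with hμ
  have hcount : ∀ i : ℕ, (outs (seqOf (fun j => φ (L j)) (fun j => φ (L' j)))).count i
      = (univ.filter fun j => (outL (L j)).val = i).card + (univ.filter fun j => (outL (L' j)).val = i).card := by
    intro i
    rw [count_outs_seqOf]
    congr 1 <;> exact congrArg _ (filter_congr fun j _ => by rw [hO])
  rw [contrib_eq, prod_boolSign_pow_eq_neg_one_pow, prod_even_indicator, card_compl_filter_val_lt hk]
  have hcond : (∀ i, k ≤ i → (outs (seqOf (fun j => φ (L j)) (fun j => φ (L' j)))).count i % 2 = 0)
      ↔ ∀ i ∈ Pᶜ, Even (μ i) := by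
    constructor
    · intro h i hi
      rw [hP, mem_compl, mem_filter, not_and] at hi
      have := h i.val (not_lt.1 (hi (mem_univ _)))
      rw [hcount, muG_nat_eq] at this
      exact Nat.even_iff.2 this
    · intro h i hki
      rw [hcount]
      by_cases him : i < m
      · have := h ⟨i, him⟩ (by rw [hP, mem_compl, mem_filter]; exact fun h' => absurd h'.2 (not_lt.2 hki))
        have hfin : (univ.filter fun j => (outL (L j)).val = i).card + (univ.filter fun j => (outL (L' j)).val = i).card
            = μ ⟨i, him⟩ := muG_nat_eq L L' ⟨i, him⟩
        rw [hfin]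
        exact Nat.even_iff.1 this
      · rw [muG_nat_eq_zero L L' (not_lt.1 him)]
  by_cases hc : ∀ i ∈ Pᶜ, Even (μ i)
  · rw [if_pos (hcond.2 hc), if_pos hc]
    have hexp : ∑ i ∈ (Finset.range k).filter (fun i => T0.getD i false = true),
        (outs (seqOf (fun j => φ (L j)) (fun j => φ (L' j)))).count i
        = ∑ i ∈ P.filter (fun i => T0.getD i.val false = true), μ i := by
      rw [Finset.sum_congr rfl (fun i _ => hcount i), sum_range_filter_eq_sum_fin hk]
      exact Finset.sum_congr rfl fun i _ => muG_nat_eq L L' i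
    rw [hexp]
    push_cast
    ring
  · rw [if_neg (fun h => hc (hcond.1 h)), if_neg hc]
    push_cast
    ring

/-! ## The sum identity -/

/-- **M3-SEM (generic leg type): THE MACHINE'S TRACE SUM IS THE CYLINDER SUM OF THE TRACES.** -/
theorem traceSum_eq_sum_cylinder_gen (hφ : Function.Injective φ) (hrl : rl.Nodup)
    (hmem : ∀ x, x ∈ rl ↔ ∃ e, φ e = x)
    (hL : ∀ e, labL (φ e) = ι₁ (srcL e)) (hR : ∀ e, labR (φ e) = ι₂ (dstL e)) (hO : ∀ e, (φ e).1 = (outL e).val)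
    (hι₁ : Function.Injective ι₁) (hι₂ : Function.Injective ι₂)
    (MR : (Fin m → Bool) → Matrix α β ℝ)
    (hMR : ∀ T i k, MR T i k = ∑ e ∈ univ.filter (fun e : Λ => srcL e = i ∧ dstL e = k),
      ((CandCutNorm.boolSign (T (outL e)) : ℤ) : ℝ))
    {k : ℕ} (hk : k ≤ m) (T0 : List Bool) (q cap : ℕ) (u : List Unit) (hu : u.length = 2 * q + 1)
    (hcap : ∀ k', k' ≤ u.length → (aseqsU rl k').length ≤ cap) :
    ((traceSum k T0 (2 ^ (m - k + 1)) rl cap u : ℤ) : ℝ)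
      = ∑ T ∈ (univ : Finset (Fin m → Bool)).filter
            (fun T => ∀ i ∈ univ.filter (fun i : Fin m => (i : ℕ) < k), T i = T0.getD i.val false),
          ((Matrix.fromBlocks 0 (MR T) (MR T)ᵀ 0) ^ (2 * (q + 1))).trace := by
  classical
  have hMR' : ∀ T i k', MR T i k' = ∑ e ∈ univ.filter (fun e : Λ => srcL e = i ∧ dstL e = k'),
      (fun _ : Λ => (1 : ℝ)) e * ((CandCutNorm.boolSign (T (outL e)) : ℤ) : ℝ) := fun T i k' => by
    rw [hMR]; exact Finset.sum_congr rfl fun e _ => by rw [one_mul]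
  rw [sum_cylinder_trace_pow_eq srcL dstL outL (fun _ => (1 : ℝ)) MR hMR' q
    (univ.filter fun i : Fin m => (i : ℕ) < k) (fun i => T0.getD i.val false),
    traceSum_eq_sum_pairs hrl q cap u hu hcap k T0 _]
  push_cast
  set eR := rlEquivG hφ hrl hmem with heR
  have hget : ∀ a : Fin rl.length, rl.get a = φ (eR a) := fun a => (φ_rlLegG hmem a).symm
  -- machine side: reindex both index functions along `eR`
  rw [Fintype.sum_equiv (Equiv.arrowCongr (Equiv.refl _) eR) _
    (fun L : Fin (q + 1) → Λ => ∑ L' : Fin (q + 1) → Λ,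
      if IsAdmissible srcL dstL L L' then
        ((contrib k T0 (2 ^ (m - k + 1)) (seqOf (fun j => φ (L j)) (fun j => φ (L' j))) : ℤ) : ℝ) else 0)
    (fun A => ?_)]
  · -- matrix side: compare termwise
    rw [Finset.mul_sum]
    refine Finset.sum_congr rfl fun L _ => ?_
    rw [Finset.mul_sum]
    refine Finset.sum_congr rfl fun L' _ => ?_
    by_cases hadm : IsAdmissible srcL dstL L L'
    · rw [if_pos hadm, if_pos hadm, contrib_seqOf_eq_gen hO hk T0 L L']
      simp only [Finset.prod_const_one, mul_one, one_mul]
    · rw [if_neg hadm, if_neg hadm, mul_zero]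
  · -- the reindexed machine term
    refine Finset.sum_equiv (Equiv.arrowCongr (Equiv.refl _) eR) (fun _ => by simp) (fun A' _ => ?_)
    have hAc : ((Equiv.refl (Fin (q + 1))).arrowCongr eR) A = fun j => eR (A j) := by
      funext j; simp [Equiv.arrowCongr_apply]
    have hAc' : ((Equiv.refl (Fin (q + 1))).arrowCongr eR) A' = fun j => eR (A' j) := by
      funext j; simp [Equiv.arrowCongr_apply]
    rw [hAc, hAc']
    have hA : ∀ j, rl.get (A j) = φ (eR (A j)) := fun j => hget (A j)
    have hA' : ∀ j, rl.get (A' j) = φ (eR (A' j)) := fun j => hget (A' j)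
    have hadm : IsAdmissible (fun a => labL (rl.get a)) (fun a => labR (rl.get a)) A A'
        ↔ IsAdmissible srcL dstL (fun j => eR (A j)) (fun j => eR (A' j)) := by
      unfold IsAdmissible
      simp only [hA, hA', hL, hR, hι₁.eq_iff, hι₂.eq_iff]
    have hseq : seqOf (fun j => rl.get (A j)) (fun j => rl.get (A' j))
        = seqOf (fun j => φ (eR (A j))) (fun j => φ (eR (A' j))) := by
      congr 1 <;> funext j
      · exact hA j
      · exact hA' j
    rw [hseq]
    by_cases h : IsAdmissible srcL dstL (fun j => eR (A j)) (fun j => eR (A' j))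
    · rw [if_pos (hadm.2 h), if_pos h]
    · rw [if_neg (fun h' => h (hadm.1 h')), if_neg h]

end Sem

end Summit.PneNP.PneNP.Theorems.Sd2BlMachine
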